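import Summits.Ventures.FusionMHD.Models.SolovevMercierProfileMargin
import Summits.Ventures.FusionMHD.Models.SolovevMercierAxisRegularIBP
import Summits.Ventures.FusionMHD.Models.SolovevMercierAxisRegularIdent
import HarnessLib

/-!
# The substituted kernels of the whole-profile Mercier lane ARE model-7's axis-regular loop integrals:
# evenness fold, Weierstrass substitution `t = 2·arctan v`, integration by parts for `D₃, D₅`, and the T-form of `N₂, N₀`

Venture LADDER-GRIDFUSION, rung F1.MERCIER-profile («F1.MERCIER-WHOLE-PROFILE»; cell `gridfusion`, seat gridfusion-sos-6 (g6),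
2026-08-27).  IDENTIFICATION PART (exact real analysis, no enclosures) linking `Models/SolovevMercierProfile{Kernels,Margin}.lean` (the eight
substituted kernels `ker I σ i s v`, their branch sums `Tint I i s`, and `slopeT` / `interceptT`) to gridfusion-model-7's
axis-regular integrals (`Models/SolovevMercierAxisRegular{,Ident,IBP}.lean`: `lcRegIB, lcRegI6, lcRegI7, lcRegI8, lcRegIX, lcRegIY,
lcRegD3, lcRegD5`, `lcRegSlopeNum = N₂`, `lcRegInterceptNum = N₀`) for ANY member of the Lee–Cerfon / PCF family whose data
`I : KInst` satisfy `I.u0 = R₀²`, `I.eps = a·R₀`, `I.invKsq = (κ²)⁻¹` (surface `r = s·a`, `0 ≤ s`, `2sa < R₀`):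

* §1 the WEIERSTRASS SUBSTITUTION on a half period: `cos(2arctan v) = (1 − v²)(1 + v²)⁻¹`, `sin²(2arctan v) = 4v²(1 + v²)⁻²`,
  `(2arctan)′ = 2(1 + v²)⁻¹`, and for every continuous `K`:
  `∫₀^π K = ∫₀¹ (K(2arctan v) + K(π − 2arctan v))·2(1 + v²)⁻¹ dv` (Mathlib `integral_comp_mul_deriv`, both quarter periods);
  the EVENNESS FOLD `∫₀^{2π} K = 2∫₀^π K` for `K(2π − t) = K(t)`;
* §2 POINTWISE: along `t = 2arctan v` (`σ = 1`) and `t = π − 2arctan v` (`σ = −1`), `u = uu I σ s v`, `cos t = cw σ v`,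
  `sin²t = s2w v`, `Q = qq I σ s v`, and each of model-7's eight integrands times `dt/dv` is the kernel `ker I σ i s v`
  (`I_X`, `I_Y`, `D₃`, `D₅` up to the constants `2/R₀`, `4`, `−3R₀`, `−5R₀`);
* §3 **`Tint_eq`**: `I_B = T₀`, `I₆ = T₁`, `I₇ = T₂`, `I₈ = T₃`, `I_X = (2/R₀)T₄`, `I_Y = 4T₅`, `D₃ = −3R₀T₆` (model-7's
  `lcRegD3_eq_sinSq`), `D₅ = −5R₀T₇` (`lcRegD5_eq_sinSq`) at `r = s·a`;
* §4 **`slopeT_eq` / `interceptT_eq`**: with `κF_B/(R₀²q₀) = κ₁R₀` and `csLC = C_s`, `slopeT I κ₁ C_s s = N₂(s·a)` and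
  `interceptT I κ₁ C_s s = N₀(s·a)`; hence **`mercier_of_margin`**: `0 < G²·slopeT − interceptT` at `s` and `0 ≤ G ≤ g` give
  `(lcGGJData κ F_B R₀ q₀ a' g (s·a)).MercierCriterion` (model-7's `mercierCriterion_lcGGJData_of_regular`) for `0 < s`.
HONEST FRAMING: exact identities about MODEL objects (ideal MHD, analytic Solov'ev surfaces); Mercier is a NECESSARY criterion;
nothing here is an enclosure or a statement about a device.
-/

noncomputable section

open Real Set MeasureTheory intervalIntegral
open Literature.MathematicalPhysics.MHD Literature.MathematicalPhysics.MHD.Solovev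
open Literature.Analysis.ValidatedNumerics Literature.Analysis.ValidatedNumerics.PolyMP

namespace Summit.Ventures.FusionMHD.Models.LcMercierProfile

open LcMercierRegular

/-! ## §1 The Weierstrass substitution on `[0, π]` and the evenness fold on `[0, 2π]` -/

/-- `1 + v² > 0`. [folklore] -/
theorem one_add_sq_pos (v : ℝ) : 0 < 1 + v * v := by nlinarith [mul_self_nonneg v]

/-- `cos(2arctan v) = (1 − v²)(1 + v²)⁻¹`. [folklore] -/
theorem cos_two_arctan (v : ℝ) : Real.cos (2 * Real.arctan v) = (1 - v * v) * (1 + v * v)⁻¹ := by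
  rw [Real.cos_two_mul, Real.cos_sq_arctan]
  have h := one_add_sq_pos v
  field_simp
  ring

/-- `sin²(2arctan v) = 4v²(1 + v²)⁻²`. [folklore] -/
theorem sin_sq_two_arctan (v : ℝ) : Real.sin (2 * Real.arctan v) ^ 2 = 4 * ((v * v * (1 + v * v)⁻¹) * (1 + v * v)⁻¹) := by
  rw [Real.sin_sq, cos_two_arctan]
  have h := one_add_sq_pos v
  field_simp
  ring

/-- `(2arctan)′(v) = 2(1 + v²)⁻¹`. [folklore] -/
theorem hasDerivAt_two_arctan (v : ℝ) : HasDerivAt (fun v => 2 * Real.arctan v) (2 * (1 + v * v)⁻¹) v := by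
  have h := (Real.hasDerivAt_arctan' v).const_mul 2
  simpa [sq] using h

/-- Continuity of `v ↦ 2(1 + v²)⁻¹`. [folklore] -/
theorem continuous_jacW : Continuous fun v : ℝ => 2 * (1 + v * v)⁻¹ :=
  continuous_const.mul ((continuous_const.add (continuous_id.mul continuous_id)).inv₀ fun v => (one_add_sq_pos v).ne')

/-- **Weierstrass substitution on `[0, π]`** (both quarter periods): for continuous `K`,
`∫₀^π K(t) dt = ∫₀¹ (K(2arctan v) + K(π − 2arctan v))·2(1 + v²)⁻¹ dv`. [folklore] -/
theorem integral_zero_pi_weierstrass (K : ℝ → ℝ) (hK : Continuous K) :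
    ∫ t in (0 : ℝ)..π, K t
      = ∫ v in (0 : ℝ)..1, (K (2 * Real.arctan v) + K (π - 2 * Real.arctan v)) * (2 * (1 + v * v)⁻¹) := by
  have hA := intervalIntegral.integral_comp_mul_deriv (f := fun v => 2 * Real.arctan v)
    (f' := fun v => 2 * (1 + v * v)⁻¹) (g := K) (a := 0) (b := 1)
    (fun v _ => hasDerivAt_two_arctan v) continuous_jacW.continuousOn hK
  have hB := intervalIntegral.integral_comp_mul_deriv (f := fun v => π - 2 * Real.arctan v)
    (f' := fun v => -(2 * (1 + v * v)⁻¹)) (g := K) (a := 0) (b := 1)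
    (fun v _ => (hasDerivAt_two_arctan v).const_sub π) continuous_jacW.neg.continuousOn hK
  simp only [Function.comp, Real.arctan_zero, Real.arctan_one, mul_zero, sub_zero] at hA hB
  rw [show 2 * (π / 4) = π / 2 by ring] at hA hB
  rw [show π - π / 2 = π / 2 by ring] at hB
  have hB' : ∫ v in (0:ℝ)..1, K (π - 2 * Real.arctan v) * (2 * (1 + v * v)⁻¹) = ∫ t in (π / 2)..π, K t := by
    rw [integral_symm π (π / 2), ← hB, ← intervalIntegral.integral_neg]
    congr 1; funext v; ring
  have hsplit : ∫ t in (0 : ℝ)..π, K t = (∫ t in (0:ℝ)..(π/2), K t) + ∫ t in (π/2)..π, K t :=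
    (integral_add_adjacent_intervals (hK.intervalIntegrable _ _) (hK.intervalIntegrable _ _)).symm
  have hcA : Continuous fun v => K (2 * Real.arctan v) * (2 * (1 + v * v)⁻¹) :=
    (hK.comp (continuous_const.mul Real.continuous_arctan)).mul continuous_jacW
  have hcB : Continuous fun v => K (π - 2 * Real.arctan v) * (2 * (1 + v * v)⁻¹) :=
    (hK.comp (continuous_const.sub (continuous_const.mul Real.continuous_arctan))).mul continuous_jacW
  rw [hsplit, ← hA, ← hB']
  rw [← intervalIntegral.integral_add (hcA.intervalIntegrable _ _) (hcB.intervalIntegrable _ _)]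
  congr 1; funext v; ring

/-- **Evenness fold**: for continuous `K` with `K(2π − t) = K(t)`, `∫₀^{2π} K = 2∫₀^π K`. [folklore] -/
theorem integral_zero_two_pi_of_symm (K : ℝ → ℝ) (hK : Continuous K) (hsym : ∀ t, K (2 * π - t) = K t) :
    ∫ t in (0 : ℝ)..(2 * π), K t = 2 * ∫ t in (0 : ℝ)..π, K t := by
  have hsplit : ∫ t in (0 : ℝ)..(2 * π), K t = (∫ t in (0:ℝ)..π, K t) + ∫ t in π..(2 * π), K t :=
    (integral_add_adjacent_intervals (hK.intervalIntegrable _ _) (hK.intervalIntegrable _ _)).symm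
  have h2 : ∫ t in π..(2 * π), K t = ∫ t in (0:ℝ)..π, K t := by
    have := intervalIntegral.integral_comp_sub_left (fun t => K t) (2 * π) (a := π) (b := 2 * π)
    rw [show 2 * π - 2 * π = (0:ℝ) by ring, show 2 * π - π = π by ring] at this
    have e : ∫ t in π..(2 * π), K (2 * π - t) = ∫ t in π..(2 * π), K t :=
      intervalIntegral.integral_congr fun t _ => hsym t
    rw [← e, this]
  rw [hsplit, h2]; ring

/-! ## §2 Pointwise dictionary along the two branches -/

section dict

variable (I : KInst) {R₀ κ a : ℝ} (hR₀ : 0 < R₀) (hκ : 0 < κ)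
  (hu0 : ((I.u0 : ℚ) : ℝ) = R₀ ^ 2) (he : ((I.eps : ℚ) : ℝ) = a * R₀) (hk : ((I.invKsq : ℚ) : ℝ) = (κ ^ 2)⁻¹)
  {s : ℝ} (hs0 : 0 ≤ s) (hsa : 2 * (s * a) < R₀) (ha : 0 ≤ a)

/-- The substituted angle of branch `σ`: `2arctan v` for `σ = 1`, `π − 2arctan v` otherwise. [folklore] -/
def tW (σ : ℚ) (v : ℝ) : ℝ := if σ = 1 then 2 * Real.arctan v else π - 2 * Real.arctan v

/-- `cos (tW σ v) = cw σ v` for `σ = ±1`. [folklore] -/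
theorem cos_tW {σ : ℚ} (hσ : σ = 1 ∨ σ = -1) (v : ℝ) : Real.cos (tW σ v) = cw σ v := by
  rcases hσ with h | h
  · subst h; simp [tW, cw, ip, cos_two_arctan]
  · subst h
    have hne : ¬ ((-1 : ℚ) = 1) := by norm_num
    rw [tW, if_neg hne, Real.cos_pi_sub, cos_two_arctan, cw, ip]
    push_cast; ring

/-- `sin² (tW σ v) = s2w v`. [folklore] -/
theorem sin_sq_tW (σ : ℚ) (v : ℝ) : Real.sin (tW σ v) ^ 2 = s2w v := by
  unfold tW s2w ip
  split
  · exact sin_sq_two_arctan v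
  · rw [Real.sin_pi_sub]; exact sin_sq_two_arctan v

include hu0 he in
/-- `u(r = s·a, tW σ v) = uu I σ s v`. [folklore] -/
theorem lcU_tW {σ : ℚ} (hσ : σ = 1 ∨ σ = -1) (v : ℝ) : lcU R₀ (s * a) (tW σ v) = uu I σ s v := by
  unfold lcU uu
  rw [cos_tW hσ, hu0]
  push_cast
  rw [he]; ring

include hR₀ hu0 he hs0 hsa ha in
/-- `u > 0` along both branches. [folklore] -/
theorem uu_pos {σ : ℚ} (hσ : σ = 1 ∨ σ = -1) (v : ℝ) : 0 < uu I σ s v := by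
  rw [← lcU_tW I hu0 he hσ v]
  exact lcU_pos hR₀ (mul_nonneg hs0 ha) hsa _

include hR₀ hκ hu0 he hk hs0 hsa ha in
/-- `Q(r, tW σ v) = qq I σ s v`. [folklore] -/
theorem lcQ_tW {σ : ℚ} (hσ : σ = 1 ∨ σ = -1) (v : ℝ) : lcQ κ R₀ (s * a) (tW σ v) = qq I σ s v := by
  have hu := uu_pos I hR₀ hu0 he hs0 hsa ha hσ v
  have hsq : Real.sqrt (uu I σ s v) ^ 2 = uu I σ s v := Real.sq_sqrt hu.le
  have hsne : Real.sqrt (uu I σ s v) ≠ 0 := (Real.sqrt_pos.2 hu).ne'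
  have hune : uu I σ s v ≠ 0 := hu.ne'
  have hκ0 : κ ≠ 0 := hκ.ne'
  unfold lcQ qq iu isu aa
  rw [lcU_tW I hu0 he hσ v, sin_sq_tW, cos_tW hσ, hk, he]
  field_simp
  rw [hsq]
  ring

include hR₀ hκ hu0 he hk hs0 hsa ha in
/-- **The eight integrands along the branches are the kernels** (model-7's integrand at `t = tW σ v`, times `dt/dv = jac v`):
components `0…5` literally; component `6` is `sin²t·(u²√u)⁻¹·jac`, component `7` is `sin²t·(u³√u)⁻¹·jac`. [folklore] -/
theorem integrand_tW {σ : ℚ} (hσ : σ = 1 ∨ σ = -1) (v : ℝ) :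
    (lcU R₀ (s * a) (tW σ v) * Real.sqrt (lcU R₀ (s * a) (tW σ v)))⁻¹ * jac v = ker I σ 0 s v
    ∧ (Real.sqrt (lcU R₀ (s * a) (tW σ v)))⁻¹ / lcQ κ R₀ (s * a) (tW σ v) * jac v = ker I σ 1 s v
    ∧ (lcU R₀ (s * a) (tW σ v) * Real.sqrt (lcU R₀ (s * a) (tW σ v)))⁻¹ / lcQ κ R₀ (s * a) (tW σ v) * jac v
        = ker I σ 2 s v
    ∧ Real.sqrt (lcU R₀ (s * a) (tW σ v)) / lcQ κ R₀ (s * a) (tW σ v) * jac v = ker I σ 3 s v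
    ∧ Real.cos (tW σ v) * (Real.sqrt (lcU R₀ (s * a) (tW σ v)))⁻¹ / lcQ κ R₀ (s * a) (tW σ v) * jac v = ker I σ 4 s v
    ∧ Real.cos (tW σ v) ^ 2 * (lcU R₀ (s * a) (tW σ v) * Real.sqrt (lcU R₀ (s * a) (tW σ v)))⁻¹
        / lcQ κ R₀ (s * a) (tW σ v) * jac v = ker I σ 5 s v
    ∧ Real.sin (tW σ v) ^ 2 * (lcU R₀ (s * a) (tW σ v) ^ 2 * Real.sqrt (lcU R₀ (s * a) (tW σ v)))⁻¹ * jac v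
        = ker I σ 6 s v
    ∧ Real.sin (tW σ v) ^ 2 * (lcU R₀ (s * a) (tW σ v) ^ 3 * Real.sqrt (lcU R₀ (s * a) (tW σ v)))⁻¹ * jac v
        = ker I σ 7 s v := by
  have hu := uu_pos I hR₀ hu0 he hs0 hsa ha hσ v
  have hQ := lcQ_tW I hR₀ hκ hu0 he hk hs0 hsa ha hσ v
  have hQpos : 0 < qq I σ s v := by
    rw [← hQ]; exact lcQ_pos hκ.ne' (by rw [lcU_tW I hu0 he hσ v]; exact hu)
  have hQne : qq I σ s v ≠ 0 := hQpos.ne'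
  rw [hQ, lcU_tW I hu0 he hσ v, sin_sq_tW, cos_tW hσ]
  simp only [ker, iu, isu]
  set q := Real.sqrt (uu I σ s v) with hq
  have hq2 : uu I σ s v = q ^ 2 := (Real.sq_sqrt hu.le).symm
  have hqne : q ≠ 0 := (Real.sqrt_pos.2 hu).ne'
  have hjne : jac v ≠ 0 := by
    unfold jac ip; exact mul_ne_zero two_ne_zero (inv_ne_zero (one_add_sq_pos v).ne')
  rw [hq2]
  refine ⟨?_, ?_, ?_, ?_, ?_, ?_, ?_, ?_⟩ <;> field_simp

end dict

/-! ## §3 The loop integrals are the branch sums -/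

section integrals

variable (I : KInst) {R₀ κ a : ℝ} (hR₀ : 0 < R₀) (hκ : 0 < κ)
  (hu0 : ((I.u0 : ℚ) : ℝ) = R₀ ^ 2) (he : ((I.eps : ℚ) : ℝ) = a * R₀) (hk : ((I.invKsq : ℚ) : ℝ) = (κ ^ 2)⁻¹)
  {s : ℝ} (hs0 : 0 ≤ s) (hsa : 2 * (s * a) < R₀) (ha : 0 ≤ a)
include hR₀ hκ hu0 he hk hs0 hsa ha

omit hR₀ hκ hu0 he hk hs0 hsa ha in
/-- Core of §3: a continuous integrand `K` whose substituted forms are the kernel `i`: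
`∫₀^{2π} K = 2·(∫₀¹ ker(+1) + ∫₀¹ ker(−1))` and `∫₀^π K = ∫₀¹ ker(+1) + ∫₀¹ ker(−1)`. [folklore] -/
theorem integral_eq_brInt (K : ℝ → ℝ) (hK : Continuous K) (i : ℕ)
    (hp : ∀ v, K (tW 1 v) * jac v = ker I 1 i s v) (hm : ∀ v, K (tW (-1) v) * jac v = ker I (-1) i s v) :
    ∫ t in (0 : ℝ)..π, K t = brInt I 1 i s + brInt I (-1) i s := by
  rw [integral_zero_pi_weierstrass K hK]
  have hcA : Continuous fun v => K (2 * Real.arctan v) * (2 * (1 + v * v)⁻¹) :=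
    (hK.comp (continuous_const.mul Real.continuous_arctan)).mul continuous_jacW
  have hcB : Continuous fun v => K (π - 2 * Real.arctan v) * (2 * (1 + v * v)⁻¹) :=
    (hK.comp (continuous_const.sub (continuous_const.mul Real.continuous_arctan))).mul continuous_jacW
  have e : ∀ v, (K (2 * Real.arctan v) + K (π - 2 * Real.arctan v)) * (2 * (1 + v * v)⁻¹)
      = K (2 * Real.arctan v) * (2 * (1 + v * v)⁻¹) + K (π - 2 * Real.arctan v) * (2 * (1 + v * v)⁻¹) := fun v => by ring
  simp_rw [e]
  rw [intervalIntegral.integral_add (hcA.intervalIntegrable _ _) (hcB.intervalIntegrable _ _)]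
  unfold brInt
  congr 1
  · refine intervalIntegral.integral_congr fun v _ => ?_
    have := hp v; simp only [tW, if_true, jac, ip] at this; simpa using this
  · refine intervalIntegral.integral_congr fun v _ => ?_
    have := hm v
    simp only [tW, jac, ip, show ((-1 : ℚ) = 1) ↔ False by norm_num, if_false] at this
    simpa using this

/-- **`I_B(s·a) = T₀(s)`, `I₆ = T₁`, `I₇ = T₂`, `I₈ = T₃`, `I_X = (2/R₀)T₄`, `I_Y = 4T₅`, `D₃ = −3R₀T₆`, `D₅ = −5R₀T₇`.**
[cite: Jardin2010, §8.5.4 eq. (8.134)] -/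
theorem Tint_eq :
    lcRegIB R₀ (s * a) = Tint I 0 s ∧ lcRegI6 κ R₀ (s * a) = Tint I 1 s ∧ lcRegI7 κ R₀ (s * a) = Tint I 2 s
    ∧ lcRegI8 κ R₀ (s * a) = Tint I 3 s ∧ lcRegIX κ R₀ (s * a) = 2 / R₀ * Tint I 4 s
    ∧ lcRegIY κ R₀ (s * a) = 4 * Tint I 5 s ∧ lcRegD3 R₀ (s * a) = -3 * R₀ * Tint I 6 s
    ∧ lcRegD5 R₀ (s * a) = -5 * R₀ * Tint I 7 s := by
  have hr : 0 ≤ s * a := mul_nonneg hs0 ha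
  obtain ⟨c0, c1, c2, c3, c4, c5, c6, -, -⟩ := continuous_regKernels hκ.ne' hR₀ hr hsa
  have hu := lcU_pos hR₀ hr hsa
  have hcu : Continuous (fun t => lcU R₀ (s * a) t) := by unfold lcU; fun_prop
  have hcs : Continuous (fun t => Real.sqrt (lcU R₀ (s * a) t)) := Real.continuous_sqrt.comp hcu
  -- symmetry `t ↦ 2π − t` of `u`, `Q`, `cos`, `sin²`
  have symU : ∀ t, lcU R₀ (s * a) (2 * π - t) = lcU R₀ (s * a) t := fun t => by
    unfold lcU; rw [Real.cos_two_pi_sub]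
  have symC : ∀ t, Real.cos (2 * π - t) = Real.cos t := fun t => Real.cos_two_pi_sub t
  have symS : ∀ t, Real.sin (2 * π - t) ^ 2 = Real.sin t ^ 2 := fun t => by rw [Real.sin_two_pi_sub]; ring
  have symQ : ∀ t, lcQ κ R₀ (s * a) (2 * π - t) = lcQ κ R₀ (s * a) t := fun t => by
    unfold lcQ; rw [symU, symC, symS]
  -- the dictionary
  have dict := fun (σ : ℚ) (hσ : σ = 1 ∨ σ = -1) (v : ℝ) => integrand_tW I hR₀ hκ hu0 he hk hs0 hsa ha hσ v
  have T : ∀ i : ℕ, i ≠ 7 → Tint I i s = 2 * (brInt I 1 i s + brInt I (-1) i s) := fun i hi => by simp [Tint, hi]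
  refine ⟨?_, ?_, ?_, ?_, ?_, ?_, ?_, ?_⟩
  · -- I_B
    rw [T 0 (by norm_num), lcRegIB, integral_zero_two_pi_of_symm _ c1 (fun t => by simp only [symU]),
      integral_eq_brInt I _ c1 0 (fun v => (dict 1 (Or.inl rfl) v).1)
        (fun v => (dict (-1) (Or.inr rfl) v).1)]
  · -- I₆
    rw [T 1 (by norm_num), lcRegI6, integral_zero_two_pi_of_symm _ c2 (fun t => by simp only [symU, symQ]),
      integral_eq_brInt I _ c2 1 (fun v => (dict 1 (Or.inl rfl) v).2.1)
        (fun v => (dict (-1) (Or.inr rfl) v).2.1)]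
  · -- I₇
    rw [T 2 (by norm_num), lcRegI7, integral_zero_two_pi_of_symm _ c3 (fun t => by simp only [symU, symQ]),
      integral_eq_brInt I _ c3 2 (fun v => (dict 1 (Or.inl rfl) v).2.2.1)
        (fun v => (dict (-1) (Or.inr rfl) v).2.2.1)]
  · -- I₈
    rw [T 3 (by norm_num), lcRegI8, integral_zero_two_pi_of_symm _ c4 (fun t => by simp only [symU, symQ]),
      integral_eq_brInt I _ c4 3 (fun v => (dict 1 (Or.inl rfl) v).2.2.2.1)
        (fun v => (dict (-1) (Or.inr rfl) v).2.2.2.1)]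
  · -- I_X: pull the constant 2/R₀
    have cX : Continuous fun t => Real.cos t * (Real.sqrt (lcU R₀ (s * a) t))⁻¹ / lcQ κ R₀ (s * a) t := by
      have e : (fun t => Real.cos t * (Real.sqrt (lcU R₀ (s * a) t))⁻¹ / lcQ κ R₀ (s * a) t)
          = fun t => R₀ / 2 * (2 * Real.cos t / R₀ * (Real.sqrt (lcU R₀ (s * a) t))⁻¹ / lcQ κ R₀ (s * a) t) := by
        funext t; field_simp
      rw [e]; exact continuous_const.mul c5
    have e1 : lcRegIX κ R₀ (s * a)
        = 2 / R₀ * ∫ t in (0:ℝ)..(2 * π), Real.cos t * (Real.sqrt (lcU R₀ (s * a) t))⁻¹ / lcQ κ R₀ (s * a) t := by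
      rw [lcRegIX, ← intervalIntegral.integral_const_mul]
      refine intervalIntegral.integral_congr fun t _ => ?_
      field_simp
    rw [T 4 (by norm_num), e1, integral_zero_two_pi_of_symm _ cX (fun t => by simp only [symU, symQ, symC]),
      integral_eq_brInt I _ cX 4 (fun v => (dict 1 (Or.inl rfl) v).2.2.2.2.1)
        (fun v => (dict (-1) (Or.inr rfl) v).2.2.2.2.1)]
  · -- I_Y: pull the constant 4
    have cY : Continuous fun t => Real.cos t ^ 2 * (lcU R₀ (s * a) t * Real.sqrt (lcU R₀ (s * a) t))⁻¹
        / lcQ κ R₀ (s * a) t := by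
      have e : (fun t => Real.cos t ^ 2 * (lcU R₀ (s * a) t * Real.sqrt (lcU R₀ (s * a) t))⁻¹ / lcQ κ R₀ (s * a) t)
          = fun t => 1 / 4 * (4 * Real.cos t ^ 2 * (lcU R₀ (s * a) t * Real.sqrt (lcU R₀ (s * a) t))⁻¹
            / lcQ κ R₀ (s * a) t) := by
        funext t; ring
      rw [e]; exact continuous_const.mul c6
    have e1 : lcRegIY κ R₀ (s * a) = 4 * ∫ t in (0:ℝ)..(2 * π),
        Real.cos t ^ 2 * (lcU R₀ (s * a) t * Real.sqrt (lcU R₀ (s * a) t))⁻¹ / lcQ κ R₀ (s * a) t := by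
      rw [lcRegIY, ← intervalIntegral.integral_const_mul]
      refine intervalIntegral.integral_congr fun t _ => ?_
      ring
    rw [T 5 (by norm_num), e1, integral_zero_two_pi_of_symm _ cY (fun t => by simp only [symU, symQ, symC]),
      integral_eq_brInt I _ cY 5 (fun v => (dict 1 (Or.inl rfl) v).2.2.2.2.2.1)
        (fun v => (dict (-1) (Or.inr rfl) v).2.2.2.2.2.1)]
  · -- D₃ via integration by parts
    have c7 : Continuous fun t => Real.sin t ^ 2 * (lcU R₀ (s * a) t ^ 2 * Real.sqrt (lcU R₀ (s * a) t))⁻¹ := by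
      refine (Real.continuous_sin.pow 2).mul ((( hcu.pow 2).mul hcs).inv₀ fun t => ?_)
      exact mul_ne_zero (pow_ne_zero 2 (hu t).ne') (Real.sqrt_pos.2 (hu t)).ne'
    rw [T 6 (by norm_num), lcRegD3_eq_sinSq hR₀ hr hsa,
      integral_zero_two_pi_of_symm _ c7 (fun t => by simp only [symU, symS]),
      integral_eq_brInt I _ c7 6 (fun v => (dict 1 (Or.inl rfl) v).2.2.2.2.2.2.1)
        (fun v => (dict (-1) (Or.inr rfl) v).2.2.2.2.2.2.1)]
  · -- D₅ via integration by parts (half period, no fold)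
    have c8 : Continuous fun t => Real.sin t ^ 2 * (lcU R₀ (s * a) t ^ 3 * Real.sqrt (lcU R₀ (s * a) t))⁻¹ := by
      refine (Real.continuous_sin.pow 2).mul ((( hcu.pow 3).mul hcs).inv₀ fun t => ?_)
      exact mul_ne_zero (pow_ne_zero 3 (hu t).ne') (Real.sqrt_pos.2 (hu t)).ne'
    have T7 : Tint I 7 s = brInt I 1 7 s + brInt I (-1) 7 s := by simp [Tint]
    rw [T7, lcRegD5_eq_sinSq hR₀ hr hsa,
      integral_eq_brInt I _ c8 7 (fun v => (dict 1 (Or.inl rfl) v).2.2.2.2.2.2.2)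
        (fun v => (dict (-1) (Or.inr rfl) v).2.2.2.2.2.2.2)]

end integrals

/-! ## §4 `N₂, N₀` in T-form and the per-surface Mercier criterion from a positive margin -/

section tform

variable (I : KInst) {R₀ κ a FB q₀ : ℝ} (hR₀ : 0 < R₀) (hκ : 0 < κ) (hFB : 0 < FB) (hq₀ : 0 < q₀)
  (hu0 : ((I.u0 : ℚ) : ℝ) = R₀ ^ 2) (he : ((I.eps : ℚ) : ℝ) = a * R₀) (hk : ((I.invKsq : ℚ) : ℝ) = (κ ^ 2)⁻¹)
  {kap1 cs : ℚ} (hkap : κ * FB / (R₀ ^ 2 * q₀) = (kap1 : ℝ) * R₀) (hcs : csLC κ FB R₀ q₀ = (cs : ℝ))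
  {s : ℝ} (hs0 : 0 ≤ s) (hsa : 2 * (s * a) < R₀) (ha : 0 ≤ a)
include hR₀ hκ hu0 he hk hkap hcs hs0 hsa ha

/-- **`slopeT I κ₁ C_s s = N₂(s·a)`.** [cite: Jardin2010, §8.5.4 eq. (8.134)] -/
theorem slopeT_eq : slopeT I kap1 cs s = lcRegSlopeNum κ FB R₀ q₀ (s * a) := by
  obtain ⟨-, h1, h2, h3, h4, h5, h6, h7⟩ := Tint_eq I hR₀ hκ hu0 he hk hs0 hsa ha
  unfold lcRegSlopeNum slopeT
  rw [hkap, hcs, h1, h2, h3, h4, h5, h6, h7]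
  have hR : R₀ ≠ 0 := hR₀.ne'
  push_cast
  rw [hu0, he]
  field_simp
  ring

/-- **`interceptT I κ₁ C_s s = N₀(s·a)`.** [cite: Jardin2010, §8.5.4 eq. (8.134)] -/
theorem interceptT_eq : interceptT I kap1 cs s = lcRegInterceptNum κ FB R₀ q₀ (s * a) := by
  obtain ⟨h0, -, -, h3, -, -, h6, -⟩ := Tint_eq I hR₀ hκ hu0 he hk hs0 hsa ha
  unfold lcRegInterceptNum interceptT
  rw [hkap, hcs, h0, h3, h6]
  push_cast
  rw [hu0, he]
  ring

include hFB hq₀ in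
/-- **From a certified margin to the criterion**: if `0 < G²·slopeT(s) − interceptT(s)`, `0 ≤ G ≤ g` and `0 < s`, then Jardin's
(8.134) Mercier criterion holds on the surface `r = s·a` of `Ψ = psiLC κ F_B R₀ q₀ a'` with free constant `g` (model-7's
`mercierCriterion_lcGGJData_of_regular`). MODELLED: ideal MHD, analytic Solov'ev surface; a NECESSARY criterion.
[cite: Jardin2010, §8.5.4 eq. (8.134)] -/
theorem mercier_of_margin (hs : 0 < s) (ha' : 0 < a) {G : ℚ} {g' : ℝ} (hG : 0 ≤ G) (hGg : (G : ℝ) ≤ g')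
    (hm : 0 < ((G ^ 2 : ℚ) : ℝ) * slopeT I kap1 cs s - interceptT I kap1 cs s) (a' : ℝ) :
    (lcGGJData κ FB R₀ q₀ a' g' (s * a)).MercierCriterion := by
  have hr : 0 < s * a := mul_pos hs ha'
  rw [slopeT_eq I hR₀ hκ hu0 he hk hkap hcs hs0 hsa ha, interceptT_eq I hR₀ hκ hu0 he hk hkap hcs hs0 hsa ha] at hm
  refine mercierCriterion_lcGGJData_of_regular hR₀ hκ hFB hq₀ hr hsa (G := (G : ℝ)) (by exact_mod_cast hG) hGg ?_
  push_cast at hm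
  linarith

end tform

end Summit.Ventures.FusionMHD.Models.LcMercierProfile

end
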